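import Summits.ResolutionOfSingularities.ResolutionOfSingularities.Theorems.HomologicalConductorNoZenoBeta1Trdeg3
import Summits.ResolutionOfSingularities.ResolutionOfSingularities.Theorems.HomologicalConductorNoZenoBranchBSurfaceDatum
import Summits.ResolutionOfSingularities.ResolutionOfSingularities.Theorems.HomologicalConductorNoZenoDim2RegularCentre
import Summits.ResolutionOfSingularities.ResolutionOfSingularities.Theorems.IndSmoothValuativeSmoothingQuadraticSequence
import Literature.AlgebraicGeometry.Resolution.QuadraticTransformsUFD
import Literature.AlgebraicGeometry.Resolution.RegularLocalRingsQuotient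
import HarnessLib

/-!
# Crux `NoZenoR` (stmt-ResolutionOfSingularities-19943), slot 2, tr.deg-3 half `Cap3`:
# `Cap3` ⟺ BOUNDED RUNG INDEX on the `k⟮t⟯`-quadratic ladder of a regular generic-fibre stage

OURS (cell res-hironaka, crux chain W4.4; lead res-L0-w44-lead-1 g10, DESK WORD 41 OBJECT 2-U).  AI-written, weaker than expert review;
nothing here is a statement of the manuscript under review (Hironaka 2017).  SUPPORT-level, counted 0.  Def-free, fact-free.

On branch (b) of `Cap3` (`…NoZenoBeta1Trdeg3`: unreachable residually transcendental `t ∈ O`, kernel binder, `IH`; a SURFACE datum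
over `k⟮t⟯` by `…NoZenoBranchBSurfaceDatum`):
* `exists_regular_genericFibreStage_dim_le` — the generic-fibre stage `D ⊇ T_m` of `GenericFibreStage.exists_regular_genericFibreStage`
  (regular, `k⟮t⟯ ⊆ D ⊆ O`, dominated by `O`) has `dim D ≤ 2` when `tr.deg_k K ≤ 3` (it is a stage of a `k⟮t⟯`-tower, `tr.deg_{k⟮t⟯} K ≤ 2`).
* `isNoetherianRing_valuationSubring_of_dominated_of_ringKrullDim_le_one` — a regular local ring of dimension `≤ 1` with fraction field
  `K`, inside `O` and dominated by `O`, IS `O` (it is a valuation ring of `K`); so `O` would be noetherian.  Hence (`exists_genericFibreLadder`)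
  under the kernel binder `dim D = 2` EXACTLY and the infinite quadratic sequence `D = R 0 → R 1 → ⋯` along `O` exists (tree
  `ValuativeSmoothing.stub_quadraticSequence`): the LADDER of `NoetherianCapture.terminates_iff_boundedCaptureIndex` exists at Cap3's binders.
* `capture_of_boundedRung` / `boundedRung_of_capture` — a bounding rung is a noetherian capturing subring of `O`; conversely (StrictDrop)
  noetherian capture terminates the tower (THM NC), and a terminating tower has bounded capture index on every ladder.
* TEXT LEVEL: `cap3_of_boundedRung3 : <BoundedRung3> → <Cap3>` and `boundedRung3_of_cap3 : <Cap3> → <BoundedRung3>`, where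
  `BoundedRung3` := Cap3's binders → «EVERY two-dimensional regular ladder along `O` containing `k` has BOUNDED CAPTURE INDEX»
  (`∃ i m₀, ∀ m ≥ m₀, T_m ⊆ R i`), written out verbatim.  OUTCOME: **Cap3 ⟺ BoundedRung3** (kernel, both directions) — the residual
  stated inside a REGULAR two-dimensional ambient: «the capture index of the `ca`-tower on the generic-fibre ladder along `O` is bounded».

References: S. Abhyankar, Amer. J. Math. 78 (1956), Lemma 12 [`Abhyankar1956Valuations`] (tree `AbhyankarQuadraticUnion_holds`).
-/

noncomputable section

-- single-problem summit: the doubled namespace component `ResolutionOfSingularities` is forced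
set_option linter.dupNamespace false

namespace Summit.ResolutionOfSingularities.ResolutionOfSingularities.Theorems.NoZeno.Beta1Trdeg3

open Summit.ResolutionOfSingularities.ResolutionOfSingularities.Theses.HomologicalConductor
open Summit.ResolutionOfSingularities.ResolutionOfSingularities.Theorems.NoZeno.Birth
open Summit.ResolutionOfSingularities.ResolutionOfSingularities.Theorems
open Summit.ResolutionOfSingularities.ResolutionOfSingularities.Theorems.NoZeno
open Summit.ResolutionOfSingularities.ResolutionOfSingularities.Theorems.NoZeno.NoetherianCapture
open Summit.ResolutionOfSingularities.ResolutionOfSingularities.Theorems.NoZeno.SandwichCluster.Parasite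
open Literature.AlgebraicGeometry.Resolution
open IsLocalRing Polynomial
open scoped IntermediateField

variable {k K : Type} [Field k] [Field K] [Algebra k K]

/-! ## Generic-fibre stages have dimension at most two -/

/-- **GENERIC-FIBRE STAGES WITH DIMENSION BOUND.**  `GenericFibreStage.exists_regular_genericFibreStage` with the extra conclusion
`dim D ≤ 2` when `tr.deg_k K ≤ 3`: the regular overring `D ⊇ T_m` produced there is a stage of the `k⟮t⟯`-tower of a finitely generated
`k⟮t⟯`-model of `K` inside `O`, and `tr.deg_{k⟮t⟯} K ≤ 2` (`trdeg_over_adjoin_le_two`), so `dim D ≤ 2` (`d2rc_ringKrullDim_tower_le`).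
Same proof as the tree theorem, one line added. [OURS: ideator res-L0-w44-idea-1, Sketch r13 §r13.2; this work] -/
theorem exists_regular_genericFibreStage_dim_le (p : ℕ) (hp : p.Prime) (k K : Type) [Field k] [CharP k p]
    [Field K] [Algebra k K] (O : ValuationSubring K) (A : Subalgebra k K)
    (hk : ∀ c : k, algebraMap k K c ∈ O) (hA : A.FG) (hfr : IsFractionRing ↥A K)
    (hAO : A.toSubring ≤ O.toSubring)
    (IH : ∀ (k' K' : Type) [Field k'] [CharP k' p] [Field K'] [Algebra k' K'] (O' : ValuationSubring K')
      (A' : Subalgebra k' K'), (∀ c : k', algebraMap k' K' c ∈ O') → A'.FG → IsFractionRing ↥A' K' →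
      A'.toSubring ≤ O'.toSubring → Algebra.trdeg k' K' < Algebra.trdeg k K →
      ∃ m : ℕ, IsRegularLocalRing ↥(tower O' A' m))
    (htr : Algebra.trdeg k K ≤ 3)
    {t : K} (htO : t ∈ O) (ht : ∀ f : k[X], f ≠ 0 → ¬ O.valuation (aeval t f) < 1) (m : ℕ) :
    ∃ D : Subalgebra k K, IsRegularLocalRing ↥D ∧ ringKrullDim ↥D ≤ 2 ∧ tower O A m ≤ D ∧
      D.toSubring ≤ O.toSubring ∧ (∀ x : K, x ∈ k⟮t⟯ → x ∈ D) ∧ (∀ x ∈ D, x⁻¹ ∈ O → x⁻¹ ∈ D) := by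
  classical
  haveI := hfr
  have htr_t : Transcendental k t := CoarseningLU.transcendental_of_residuallyTranscendental O ht
  have hFO : ∀ x : K, x ∈ k⟮t⟯ → x ∈ O := fun x hx => CoarseningLU.adjoin_simple_le O htO ht hk hx
  set F : IntermediateField k K := k⟮t⟯ with hFdef
  haveI : CharP (↥F) p := charP_of_injective_algebraMap (algebraMap k (↥F)).injective p
  have hkF : ∀ c : ↥F, algebraMap (↥F) K c ∈ O := fun c => hFO c c.2
  have htrF : Algebra.trdeg (↥F) K ≤ 2 := trdeg_over_adjoin_le_two O htr ht
  -- a finitely generated presentation of the stage `T_m`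
  have hshape : (∃ B : Subalgebra k K, B.FG ∧ B ≤ tower O A m ∧
      loc O B = tower O A m ∧ ∀ x ∈ tower O A m, ∃ b ∈ B, ∃ s ∈ B, s⁻¹ ∈ O ∧ x = b * s⁻¹) ∧
      IsNoetherianRing ↥(tower O A m) ∧ (tower O A m).toSubring ≤ O.toSubring ∧
      ∀ s ∈ tower O A m, s⁻¹ ∈ O → s⁻¹ ∈ tower O A m :=
    StrictDrop.Birth.TowerShape.stub_towerShape p hp k K O A hk hA hfr hAO m
  obtain ⟨⟨B, hBfg, hBT, -, hfrac⟩, -, hTO, -⟩ := hshape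
  obtain ⟨SB, hSB⟩ := hBfg
  obtain ⟨SA, hSA⟩ := id hA
  have hSAA : (SA : Set K) ⊆ A := by rw [← hSA]; exact Algebra.subset_adjoin
  have hSBB : (SB : Set K) ⊆ B := by rw [← hSB]; exact Algebra.subset_adjoin
  -- the `k⟮t⟯`-model `A' = k⟮t⟯[SA ∪ SB]`
  let A' : Subalgebra (↥F) K := Algebra.adjoin (↥F) ((SA ∪ SB : Finset K) : Set K)
  have hA'fg : A'.FG := Subalgebra.fg_adjoin_finset _
  have hgen : ∀ x : K, x ∈ ((SA ∪ SB : Finset K) : Set K) → x ∈ A' := fun x hx => Algebra.subset_adjoin hx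
  have hAA' : ∀ x : K, x ∈ A → x ∈ A' := by
    have h : A ≤ A'.restrictScalars k := by
      rw [← hSA]
      refine Algebra.adjoin_le fun y hy => ?_
      rw [Subalgebra.coe_restrictScalars]
      exact hgen y (by simp only [Finset.coe_union, Set.mem_union, Finset.mem_coe] at hy ⊢; exact Or.inl hy)
    exact fun x hx => (Subalgebra.mem_restrictScalars k).mp (h hx)
  have hBA' : ∀ x : K, x ∈ B → x ∈ A' := by
    have h : B ≤ A'.restrictScalars k := by
      rw [← hSB]
      refine Algebra.adjoin_le fun y hy => ?_
      rw [Subalgebra.coe_restrictScalars]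
      exact hgen y (by simp only [Finset.coe_union, Set.mem_union, Finset.mem_coe] at hy ⊢; exact Or.inr hy)
    exact fun x hx => (Subalgebra.mem_restrictScalars k).mp (h hx)
  have hA'O : A'.toSubring ≤ O.toSubring := by
    refine SyzygyFlattening.adjoin_toSubring_le_valuationSubring O hkF fun x hx => ?_
    simp only [Finset.coe_union, Set.mem_union, Finset.mem_coe] at hx
    rcases hx with hx | hx
    · exact hAO (hSAA (Finset.mem_coe.mpr hx))
    · exact hTO (hBT (hSBB (Finset.mem_coe.mpr hx)))
  have hA'fr : IsFractionRing ↥A' K := by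
    refine IsFractionRing.of_field ↥A' K fun z => ?_
    obtain ⟨a, b, -, rfl⟩ := IsFractionRing.div_surjective (A := ↥A) z
    exact ⟨⟨a, hAA' a a.2⟩, ⟨b, hAA' b b.2⟩, rfl⟩
  -- the transcendence degree drops by one
  have htr' : Algebra.trdeg (↥F) K < Algebra.trdeg k K :=
    GenericFibreStage.trdeg_adjoin_simple_lt htr_t (GenericFibreStage.trdeg_lt_aleph0_of_subalgebra_fg A hA hfr)
  -- the induction hypothesis over `k⟮t⟯`
  obtain ⟨M, hM⟩ := IH (↥F) K O A' hkF hA'fg hA'fr hA'O htr'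
  -- the dimension bound over the ground field `k⟮t⟯`
  have hdimM : ringKrullDim ↥(tower O A' M) ≤ 2 := d2rc_ringKrullDim_tower_le O A' M htrF
  refine ⟨(tower O A' M).restrictScalars k, ?_, ?_, ?_, ?_, ?_, ?_⟩
  · exact hM
  · exact hdimM
  · intro x hx
    rw [Subalgebra.mem_restrictScalars]
    obtain ⟨b, hb, s, hs, hsO, rfl⟩ := hfrac x hx
    exact (tower O A' M).mul_mem (mem_tower_of_mem O A' M b (hBA' b hb))
      (TraceSocle.inv_mem_stage O A' hkF hA'O M s (mem_tower_of_mem O A' M s (hBA' s hs)) hsO)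
  · intro x hx
    exact TraceSocle.stage_le O A' hkF hA'O M x ((Subalgebra.mem_restrictScalars k).mp hx)
  · intro x hx
    rw [Subalgebra.mem_restrictScalars]
    exact (tower O A' M).algebraMap_mem (⟨x, hx⟩ : ↥F)
  · intro x hx hxO
    rw [Subalgebra.mem_restrictScalars] at hx ⊢
    exact TraceSocle.inv_mem_stage O A' hkF hA'O M x hx hxO

/-! ## A regular local ring of dimension `≤ 1` dominated by `O` is `O` -/

/-- **A valuation ring of `K` inside `O` and dominated by `O` contains `O`**: for a `k`-subalgebra `D ⊆ O` with `Frac D = K` which is a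
valuation ring and whose `O`-units are units, every `z ∈ O` lies in `D` (`z ∈ D` or `z⁻¹ ∈ D`; in the second case `z = (z⁻¹)⁻¹ ∈ O`
forces `z ∈ D` by domination). [folklore] -/
theorem mem_of_valuationRing_of_dominated (O : ValuationSubring K) (D : Subalgebra k K) [ValuationRing ↥D]
    [IsFractionRing ↥D K] (hdom : ∀ x ∈ D, x⁻¹ ∈ O → x⁻¹ ∈ D) : ∀ z : K, z ∈ O → z ∈ D := by
  intro z hz
  rcases ValuationRing.isInteger_or_isInteger (R := ↥D) (K := K) z with ⟨d, hd⟩ | ⟨d, hd⟩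
  · rw [← hd]; exact d.2
  · by_cases hz0 : z = 0
    · rw [hz0]; exact D.zero_mem
    · have hzinv : z⁻¹ ∈ D := by rw [← hd]; exact d.2
      have := hdom z⁻¹ hzinv (by rw [inv_inv]; exact hz)
      rwa [inv_inv] at this

/-- **A regular local ring of dimension `≤ 1` with fraction field `K`, inside `O` and dominated by `O`, makes `O` noetherian** (indeed
`O = D`: `D` is a principal ideal ring, hence a valuation ring of `K`, and `mem_of_valuationRing_of_dominated`).
[cite: Matsumura1987, Thm. 11.2] -/
theorem isNoetherianRing_valuationSubring_of_dominated_of_ringKrullDim_le_one (O : ValuationSubring K)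
    (A D : Subalgebra k K) (hfr : IsFractionRing ↥A K) (hAD : A ≤ D) (hreg : IsRegularLocalRing ↥D)
    (hdim : ringKrullDim ↥D ≤ 1) (hDO : D.toSubring ≤ O.toSubring) (hdom : ∀ x ∈ D, x⁻¹ ∈ O → x⁻¹ ∈ D) :
    IsNoetherianRing ↥O := by
  haveI := hfr
  haveI := hreg
  haveI : IsFractionRing ↥D K := isFractionRing_subalgebra_of_le A D hAD
  haveI : IsPrincipalIdealRing ↥D := isPrincipalIdealRing_of_ringKrullDim_le_one hdim
  have hOD : ∀ z : K, z ∈ O → z ∈ D := mem_of_valuationRing_of_dominated O D hdom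
  -- `O = D` as subrings of `K`; transport noetherianity along the inclusion `D ↪ O`, which is onto
  let f : ↥D.toSubring →+* ↥O.toSubring := Subring.inclusion hDO
  have hf : Function.Surjective f := fun ⟨z, hz⟩ => ⟨⟨z, hOD z hz⟩, rfl⟩
  haveI : IsNoetherianRing ↥D.toSubring := (inferInstance : IsNoetherianRing ↥D)
  exact isNoetherianRing_of_surjective _ _ f hf

/-! ## The ladder exists at Cap3's binders -/

/-- **THE GENERIC-FIBRE LADDER (fact-free).**  For a datum `(O, A)` of the canonical `ca`-tower with `tr.deg_k K ≤ 3`, `O` NOT noetherian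
(the kernel binder at `O`), the induction hypothesis `IH`, a residually transcendental `t ∈ O` and any stage `T_m`: there is an infinite
sequence `R 0 → R 1 → ⋯` of QUADRATIC TRANSFORMS ALONG `O` starting at a TWO-dimensional regular local ring `R 0` of `K` dominated by `O`,
containing `k`, `k⟮t⟯` and the stage `T_m` — `R 0` is the generic-fibre stage (`exists_regular_genericFibreStage_dim_le`; its dimension is
`≤ 2`, and `≤ 1` is excluded by `isNoetherianRing_valuationSubring_of_dominated_of_ringKrullDim_le_one`), and the sequence is the tree's
`ValuativeSmoothing.stub_quadraticSequence`.  This is the ladder of `NoetherianCapture.stage_captured_by_rung` /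
`terminates_iff_boundedCaptureIndex`. [this work; cite: Abhyankar1956Valuations, Lemma 12] -/
theorem exists_genericFibreLadder (p : ℕ) (hp : p.Prime) (k K : Type) [Field k] [CharP k p]
    [Field K] [Algebra k K] (O : ValuationSubring K) (A : Subalgebra k K)
    (hk : ∀ c : k, algebraMap k K c ∈ O) (hA : A.FG) (hfr : IsFractionRing ↥A K)
    (hAO : A.toSubring ≤ O.toSubring)
    (IH : ∀ (k' K' : Type) [Field k'] [CharP k' p] [Field K'] [Algebra k' K'] (O' : ValuationSubring K')
      (A' : Subalgebra k' K'), (∀ c : k', algebraMap k' K' c ∈ O') → A'.FG → IsFractionRing ↥A' K' →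
      A'.toSubring ≤ O'.toSubring → Algebra.trdeg k' K' < Algebra.trdeg k K →
      ∃ m : ℕ, IsRegularLocalRing ↥(tower O' A' m))
    (htr : Algebra.trdeg k K ≤ 3) (hO : ¬ IsNoetherianRing ↥O)
    {t : K} (htO : t ∈ O) (ht : ∀ f : k[X], f ≠ 0 → ¬ O.valuation (aeval t f) < 1) (m : ℕ) :
    ∃ R : ℕ → Subring K, IsRegularLocalRing ↥(R 0) ∧ ringKrullDim ↥(R 0) = 2 ∧ IsLocalRingOf (R 0) ∧
      SubringDominates (R 0) O.toSubring ∧ (∀ i : ℕ, IsQuadraticTransformAlong O (R i) (R (i + 1))) ∧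
      (∀ c : k, algebraMap k K c ∈ R 0) ∧ (∀ x ∈ tower O A m, x ∈ R 0) ∧ (∀ x : K, x ∈ k⟮t⟯ → x ∈ R 0) := by
  haveI := hfr
  obtain ⟨D, hreg, hdimle, hTD, hDO, hFD, hdom⟩ :=
    exists_regular_genericFibreStage_dim_le p hp k K O A hk hA hfr hAO IH htr htO ht m
  haveI := hreg
  have hAD : A ≤ D := fun a ha => hTD (mem_tower_of_mem O A m a ha)
  -- `dim D = 2` exactly
  have hdim : ringKrullDim ↥D = 2 := by
    obtain ⟨n, hn⟩ := exists_nat_cast_eq_ringKrullDim (R := ↥D)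
    rw [hn] at hdimle ⊢
    have hn2 : n ≤ 2 := by exact_mod_cast hdimle
    rcases Nat.lt_or_ge n 2 with hlt | hge
    · exfalso
      have h1 : ringKrullDim ↥D ≤ 1 := by rw [hn]; exact_mod_cast (Nat.lt_succ_iff.mp hlt)
      exact hO (isNoetherianRing_valuationSubring_of_dominated_of_ringKrullDim_le_one O A D hfr hAD hreg h1 hDO hdom)
    · have : n = 2 := le_antisymm hn2 hge
      subst this; rfl
  -- `D` as a local ring OF `K`, dominated by `O`
  have hregS : IsRegularLocalRing ↥D.toSubring := hreg
  have hof : IsLocalRingOf D.toSubring := by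
    refine ⟨(inferInstance : IsLocalRing ↥D), fun z => ?_⟩
    obtain ⟨a, b, hb, rfl⟩ := IsFractionRing.div_surjective (A := ↥A) z
    exact ⟨a, hAD a.2, b, hAD b.2, by exact_mod_cast nonZeroDivisors.ne_zero hb, rfl⟩
  have hdomR : SubringDominates D.toSubring O.toSubring := ⟨hDO, fun x hx hxO => hdom x hx hxO⟩
  -- `O ≠ K` (a field is noetherian; tree `NoZeno.Negative.ne_top_of_not_isNoetherianRing`, inlined)
  have hOtop : O ≠ ⊤ := by
    rintro rfl
    exact hO (isNoetherianRing_of_ringEquiv K (Subring.topEquiv (R := K)).symm)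
  obtain ⟨R, hR0, hstep⟩ := ValuativeSmoothing.stub_quadraticSequence O hOtop D.toSubring hregS hof hdomR
  refine ⟨R, ?_, ?_, ?_, ?_, hstep, ?_, ?_, ?_⟩ <;> try rw [hR0]
  exacts [hregS, hdim, hof, hdomR, fun c => D.algebraMap_mem c, fun x hx => hTD hx, fun x hx => hFD x hx]

/-! ## Bounded rung index versus noetherian capture (object level) -/

/-- **A RUNG CONTAINING ALL LATE STAGES IS A NOETHERIAN CAPTURING SUBRING OF `O`.**  For a ladder `R_•` along `O` from a regular `R 0 ∋ k`
dominated by `O`: if `T_m ⊆ R i` for all `m ≥ m₀` then `N := R i` (a regular local ring — tree `isRegularLocalRing_sequence` — hence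
noetherian, inside `O`) contains `ca(T_m) ⊆ T_m` for all `m ≥ m₀`. [this work; cite: Abhyankar1956Valuations, Lemma 12] -/
theorem capture_of_boundedRung (O : ValuationSubring K) (A : Subalgebra k K) (R : ℕ → Subring K)
    (hreg : IsRegularLocalRing ↥(R 0)) (hdomR : SubringDominates (R 0) O.toSubring)
    (hstep : ∀ i : ℕ, IsQuadraticTransformAlong O (R i) (R (i + 1))) (hkR : ∀ c : k, algebraMap k K c ∈ R 0)
    {i m₀ : ℕ} (hcap : ∀ m : ℕ, m₀ ≤ m → ∀ x ∈ tower O A m, x ∈ R i) :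
    ∃ (N : Subalgebra k K) (m₀ : ℕ), IsNoetherianRing ↥N ∧ N.toSubring ≤ O.toSubring ∧
      ∀ m : ℕ, m₀ ≤ m → ∀ x ∈ ca (tower O A m), x ∈ N := by
  have hmono : Monotone R := sequence_monotone hstep
  let Ri : Subalgebra k K :=
    { carrier := R i
      mul_mem' := fun ha hb => (R i).mul_mem ha hb
      one_mem' := (R i).one_mem
      add_mem' := fun ha hb => (R i).add_mem ha hb
      zero_mem' := (R i).zero_mem
      algebraMap_mem' := fun c => hmono (Nat.zero_le i) (hkR c) }
  haveI : IsRegularLocalRing ↥(R i) := isRegularLocalRing_sequence hreg hstep i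
  have hRN : IsNoetherianRing ↥Ri := (inferInstance : IsNoetherianRing ↥(R i))
  refine ⟨Ri, m₀, hRN, fun x hx => (sequence_dominates hdomR hstep i).1.1 hx, fun m hm x hx => ?_⟩
  exact hcap m hm x (ca_subset _ hx)

/-- **NOETHERIAN CAPTURE BOUNDS THE RUNG INDEX (under StrictDrop).**  If some noetherian `k`-subalgebra `N ⊆ O` contains `ca(T_m)` for
all late `m`, then the tower has a regular stage (THM NC `terminates_of_noetherianCapture_subalgebra`), and then EVERY two-dimensional
regular ladder along `O` has bounded capture index (`terminates_iff_boundedCaptureIndex`). [this work] -/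
theorem boundedRung_of_capture (hD : StrictDrop) (p : ℕ) (hp : p.Prime) (k K : Type) [Field k] [CharP k p]
    [Field K] [Algebra k K] (O : ValuationSubring K) (A : Subalgebra k K)
    (hk : ∀ c : k, algebraMap k K c ∈ O) (hA : A.FG) (hfr : IsFractionRing ↥A K)
    (hAO : A.toSubring ≤ O.toSubring) (N : Subalgebra k K) (hN : IsNoetherianRing ↥N)
    (hNO : N.toSubring ≤ O.toSubring) (m₀ : ℕ) (hcap : ∀ m : ℕ, m₀ ≤ m → ∀ x ∈ ca (tower O A m), x ∈ N)
    (R : ℕ → Subring K) (hreg : IsRegularLocalRing ↥(R 0)) (hdim : ringKrullDim ↥(R 0) = 2)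
    (hof : IsLocalRingOf (R 0)) (hdomR : SubringDominates (R 0) O.toSubring)
    (hstep : ∀ i : ℕ, IsQuadraticTransformAlong O (R i) (R (i + 1))) (hkR : ∀ c : k, algebraMap k K c ∈ R 0) :
    ∃ i m₁ : ℕ, ∀ m : ℕ, m₁ ≤ m → ∀ x ∈ tower O A m, x ∈ R i :=
  (terminates_iff_boundedCaptureIndex hD p hp k K O A hk hA hfr hAO R hreg hdim hof hdomR hstep hkR).mp
    (terminates_of_noetherianCapture_subalgebra hD p hp k K O A hk hA hfr hAO N hN hNO m₀ hcap)


/-! ## TEXT LEVEL: `Cap3` ⟺ `BoundedRung3` -/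

/-- **THE LADDER AT Cap3's BINDERS.**  At the binders of `Cap3` (kernel binder, `IH`, `tr.deg_k K = 3`, branch (b)) and for every stage
`T_m`, the generic-fibre ladder of `exists_genericFibreLadder` exists: a two-dimensional regular local ring `R 0 ⊇ T_m` of `K` containing
`k` and `k⟮t⟯`, dominated by `O`, with its infinite quadratic sequence along `O`. [this work] -/
theorem exists_ladder_of_cap3Binders (p : ℕ) (hp : p.Prime) (k K : Type) [Field k] [CharP k p]
    [Field K] [Algebra k K] (O : ValuationSubring K) (A : Subalgebra k K)
    (hk : ∀ c : k, algebraMap k K c ∈ O) (hA : A.FG) (hfr : IsFractionRing ↥A K)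
    (hAO : A.toSubring ≤ O.toSubring)
    (hker : ∀ O' : ValuationSubring K,
      (∀ m : ℕ, ∀ s ∈ tower O A m, s ∈ O' ∧ (s⁻¹ ∈ O' → s⁻¹ ∈ O)) → ¬ IsNoetherianRing ↥O')
    (IH : ∀ (k' K' : Type) [Field k'] [CharP k' p] [Field K'] [Algebra k' K'] (O' : ValuationSubring K')
      (A' : Subalgebra k' K'), (∀ c : k', algebraMap k' K' c ∈ O') → A'.FG → IsFractionRing ↥A' K' →
      A'.toSubring ≤ O'.toSubring → Algebra.trdeg k' K' < Algebra.trdeg k K →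
      ∃ m : ℕ, IsRegularLocalRing ↥(tower O' A' m))
    (htr : Algebra.trdeg k K = 3)
    (hb : ∃ t : K, t ∈ O ∧ (∀ m : ℕ, t ∉ tower O A m) ∧
      ∀ f : Polynomial k, f ≠ 0 → ¬ O.valuation (Polynomial.aeval t f) < 1) (m : ℕ) :
    ∃ R : ℕ → Subring K, IsRegularLocalRing ↥(R 0) ∧ ringKrullDim ↥(R 0) = 2 ∧ IsLocalRingOf (R 0) ∧
      SubringDominates (R 0) O.toSubring ∧ (∀ i : ℕ, IsQuadraticTransformAlong O (R i) (R (i + 1))) ∧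
      (∀ c : k, algebraMap k K c ∈ R 0) ∧ (∀ x ∈ tower O A m, x ∈ R 0) ∧
      ∃ t : K, (∀ n : ℕ, t ∉ tower O A n) ∧ ∀ x : K, x ∈ k⟮t⟯ → x ∈ R 0 := by
  obtain ⟨t, htO, htT, ht⟩ := hb
  obtain ⟨R, h1, h2, h3, h4, h5, h6, h7, h8⟩ := exists_genericFibreLadder p hp k K O A hk hA hfr hAO IH (le_of_eq htr)
    (not_isNoetherianRing_of_kernel O A hk hAO hker) htO ht m
  exact ⟨R, h1, h2, h3, h4, h5, h6, h7, t, htT, h8⟩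

/-- **`Cap3` FROM BOUNDED RUNG INDEX.**  `h` = BoundedRung3 := Cap3's binders → «every two-dimensional regular ladder along `O` containing
`k` has bounded capture index»; conclusion = the `Cap3` text of `…NoZenoBeta1Trdeg3` (binder `d` of `beta1RankOneSharpF_of_split`)
verbatim.  Proof: the generic-fibre ladder exists (`exists_genericFibreLadder`); its bounding rung is the capturing ring
(`capture_of_boundedRung`). [this work] -/
theorem cap3_of_boundedRung3
    (h :
      PersistenceRadical → StrictDrop → ∀ p : ℕ, p.Prime → ∀ (k K : Type) [Field k] [CharP k p] [Field K]
        [Algebra k K] (O : ValuationSubring K) (A : Subalgebra k K), (∀ c : k, algebraMap k K c ∈ O) →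
        A.FG → IsFractionRing ↥A K → A.toSubring ≤ O.toSubring →
        (∀ O' : ValuationSubring K,
          (∀ m : ℕ, ∀ s ∈ tower O A m, s ∈ O' ∧ (s⁻¹ ∈ O' → s⁻¹ ∈ O)) → ¬ IsNoetherianRing ↥O') →
        (∀ O' : ValuationSubring K, O < O' → ∃ m : ℕ, ∃ s ∈ tower O A m, s⁻¹ ∈ O' ∧ s⁻¹ ∉ O) →
        (∀ (k' K' : Type) [Field k'] [CharP k' p] [Field K'] [Algebra k' K'] (O' : ValuationSubring K')
          (A' : Subalgebra k' K'), (∀ c : k', algebraMap k' K' c ∈ O') → A'.FG → IsFractionRing ↥A' K' →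
          A'.toSubring ≤ O'.toSubring → Algebra.trdeg k' K' < Algebra.trdeg k K →
          ∃ m : ℕ, IsRegularLocalRing ↥(tower O' A' m)) →
        (∀ m : ℕ, ∀ s ∈ tower O A m, ∃ f : Polynomial k, f ≠ 0 ∧ O.valuation (Polynomial.aeval s f) < 1) →
        Algebra.trdeg k K = 3 →
        (∀ O₁ : ValuationSubring K, O < O₁ → O₁ = ⊤) →
        (∃ t : K, t ∈ O ∧ (∀ m : ℕ, t ∉ tower O A m) ∧
          ∀ f : Polynomial k, f ≠ 0 → ¬ O.valuation (Polynomial.aeval t f) < 1) →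
        ¬ SingularPrimeThread O A →
        ∀ R : ℕ → Subring K, IsRegularLocalRing ↥(R 0) → ringKrullDim ↥(R 0) = 2 → IsLocalRingOf (R 0) →
          SubringDominates (R 0) O.toSubring → (∀ i : ℕ, IsQuadraticTransformAlong O (R i) (R (i + 1))) →
          (∀ c : k, algebraMap k K c ∈ R 0) →
          ∃ i m₀ : ℕ, ∀ m : ℕ, m₀ ≤ m → ∀ x ∈ tower O A m, x ∈ R i) :
    PersistenceRadical → StrictDrop → ∀ p : ℕ, p.Prime → ∀ (k K : Type) [Field k] [CharP k p] [Field K]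
      [Algebra k K] (O : ValuationSubring K) (A : Subalgebra k K), (∀ c : k, algebraMap k K c ∈ O) →
      A.FG → IsFractionRing ↥A K → A.toSubring ≤ O.toSubring →
      (∀ O' : ValuationSubring K,
        (∀ m : ℕ, ∀ s ∈ tower O A m, s ∈ O' ∧ (s⁻¹ ∈ O' → s⁻¹ ∈ O)) → ¬ IsNoetherianRing ↥O') →
      (∀ O' : ValuationSubring K, O < O' → ∃ m : ℕ, ∃ s ∈ tower O A m, s⁻¹ ∈ O' ∧ s⁻¹ ∉ O) →
      (∀ (k' K' : Type) [Field k'] [CharP k' p] [Field K'] [Algebra k' K'] (O' : ValuationSubring K')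
        (A' : Subalgebra k' K'), (∀ c : k', algebraMap k' K' c ∈ O') → A'.FG → IsFractionRing ↥A' K' →
        A'.toSubring ≤ O'.toSubring → Algebra.trdeg k' K' < Algebra.trdeg k K →
        ∃ m : ℕ, IsRegularLocalRing ↥(tower O' A' m)) →
      (∀ m : ℕ, ∀ s ∈ tower O A m, ∃ f : Polynomial k, f ≠ 0 ∧ O.valuation (Polynomial.aeval s f) < 1) →
      Algebra.trdeg k K = 3 →
      (∀ O₁ : ValuationSubring K, O < O₁ → O₁ = ⊤) →
      (∃ t : K, t ∈ O ∧ (∀ m : ℕ, t ∉ tower O A m) ∧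
        ∀ f : Polynomial k, f ≠ 0 → ¬ O.valuation (Polynomial.aeval t f) < 1) →
      ¬ SingularPrimeThread O A →
      ∃ (N : Subalgebra k K) (m₀ : ℕ), IsNoetherianRing ↥N ∧ N.toSubring ≤ O.toSubring ∧
        ∀ m : ℕ, m₀ ≤ m → ∀ x ∈ ca (tower O A m), x ∈ N := by
  intro hP hD p hp k K _ _ _ _ O A hk hA hfr hAO hker hmax IH hzd htr hr1 hb hthr
  obtain ⟨R, hreg, hdim, hof, hdomR, hstep, hkR, -, -⟩ :=
    exists_ladder_of_cap3Binders p hp k K O A hk hA hfr hAO hker IH htr hb 0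
  obtain ⟨i, m₀, hcap⟩ :=
    h hP hD p hp k K O A hk hA hfr hAO hker hmax IH hzd htr hr1 hb hthr R hreg hdim hof hdomR hstep hkR
  exact capture_of_boundedRung O A R hreg hdomR hstep hkR hcap

/-- **BOUNDED RUNG INDEX FROM `Cap3`** (the converse; `h` = the `Cap3` text verbatim, conclusion = BoundedRung3): noetherian capture
terminates the tower under `StrictDrop` (THM NC) and a terminating tower has bounded capture index on every ladder
(`boundedRung_of_capture`).  So the re-cut loses nothing: **Cap3 ⟺ BoundedRung3**. [this work] -/
theorem boundedRung3_of_cap3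
    (h :
      PersistenceRadical → StrictDrop → ∀ p : ℕ, p.Prime → ∀ (k K : Type) [Field k] [CharP k p] [Field K]
        [Algebra k K] (O : ValuationSubring K) (A : Subalgebra k K), (∀ c : k, algebraMap k K c ∈ O) →
        A.FG → IsFractionRing ↥A K → A.toSubring ≤ O.toSubring →
        (∀ O' : ValuationSubring K,
          (∀ m : ℕ, ∀ s ∈ tower O A m, s ∈ O' ∧ (s⁻¹ ∈ O' → s⁻¹ ∈ O)) → ¬ IsNoetherianRing ↥O') →
        (∀ O' : ValuationSubring K, O < O' → ∃ m : ℕ, ∃ s ∈ tower O A m, s⁻¹ ∈ O' ∧ s⁻¹ ∉ O) →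
        (∀ (k' K' : Type) [Field k'] [CharP k' p] [Field K'] [Algebra k' K'] (O' : ValuationSubring K')
          (A' : Subalgebra k' K'), (∀ c : k', algebraMap k' K' c ∈ O') → A'.FG → IsFractionRing ↥A' K' →
          A'.toSubring ≤ O'.toSubring → Algebra.trdeg k' K' < Algebra.trdeg k K →
          ∃ m : ℕ, IsRegularLocalRing ↥(tower O' A' m)) →
        (∀ m : ℕ, ∀ s ∈ tower O A m, ∃ f : Polynomial k, f ≠ 0 ∧ O.valuation (Polynomial.aeval s f) < 1) →
        Algebra.trdeg k K = 3 →
        (∀ O₁ : ValuationSubring K, O < O₁ → O₁ = ⊤) →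
        (∃ t : K, t ∈ O ∧ (∀ m : ℕ, t ∉ tower O A m) ∧
          ∀ f : Polynomial k, f ≠ 0 → ¬ O.valuation (Polynomial.aeval t f) < 1) →
        ¬ SingularPrimeThread O A →
        ∃ (N : Subalgebra k K) (m₀ : ℕ), IsNoetherianRing ↥N ∧ N.toSubring ≤ O.toSubring ∧
          ∀ m : ℕ, m₀ ≤ m → ∀ x ∈ ca (tower O A m), x ∈ N) :
    PersistenceRadical → StrictDrop → ∀ p : ℕ, p.Prime → ∀ (k K : Type) [Field k] [CharP k p] [Field K]
      [Algebra k K] (O : ValuationSubring K) (A : Subalgebra k K), (∀ c : k, algebraMap k K c ∈ O) →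
      A.FG → IsFractionRing ↥A K → A.toSubring ≤ O.toSubring →
      (∀ O' : ValuationSubring K,
        (∀ m : ℕ, ∀ s ∈ tower O A m, s ∈ O' ∧ (s⁻¹ ∈ O' → s⁻¹ ∈ O)) → ¬ IsNoetherianRing ↥O') →
      (∀ O' : ValuationSubring K, O < O' → ∃ m : ℕ, ∃ s ∈ tower O A m, s⁻¹ ∈ O' ∧ s⁻¹ ∉ O) →
      (∀ (k' K' : Type) [Field k'] [CharP k' p] [Field K'] [Algebra k' K'] (O' : ValuationSubring K')
        (A' : Subalgebra k' K'), (∀ c : k', algebraMap k' K' c ∈ O') → A'.FG → IsFractionRing ↥A' K' →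
        A'.toSubring ≤ O'.toSubring → Algebra.trdeg k' K' < Algebra.trdeg k K →
        ∃ m : ℕ, IsRegularLocalRing ↥(tower O' A' m)) →
      (∀ m : ℕ, ∀ s ∈ tower O A m, ∃ f : Polynomial k, f ≠ 0 ∧ O.valuation (Polynomial.aeval s f) < 1) →
      Algebra.trdeg k K = 3 →
      (∀ O₁ : ValuationSubring K, O < O₁ → O₁ = ⊤) →
      (∃ t : K, t ∈ O ∧ (∀ m : ℕ, t ∉ tower O A m) ∧
        ∀ f : Polynomial k, f ≠ 0 → ¬ O.valuation (Polynomial.aeval t f) < 1) →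
      ¬ SingularPrimeThread O A →
      ∀ R : ℕ → Subring K, IsRegularLocalRing ↥(R 0) → ringKrullDim ↥(R 0) = 2 → IsLocalRingOf (R 0) →
        SubringDominates (R 0) O.toSubring → (∀ i : ℕ, IsQuadraticTransformAlong O (R i) (R (i + 1))) →
        (∀ c : k, algebraMap k K c ∈ R 0) →
        ∃ i m₀ : ℕ, ∀ m : ℕ, m₀ ≤ m → ∀ x ∈ tower O A m, x ∈ R i := by
  intro hP hD p hp k K _ _ _ _ O A hk hA hfr hAO hker hmax IH hzd htr hr1 hb hthr R hreg hdim hof hdomR hstep hkR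
  obtain ⟨N, m₀, hN, hNO, hcap⟩ := h hP hD p hp k K O A hk hA hfr hAO hker hmax IH hzd htr hr1 hb hthr
  exact boundedRung_of_capture hD p hp k K O A hk hA hfr hAO N hN hNO m₀ hcap R hreg hdim hof hdomR hstep hkR

end Summit.ResolutionOfSingularities.ResolutionOfSingularities.Theorems.NoZeno.Beta1Trdeg3

end
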